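import Summits.BirchSwinnertonDyer.BirchSwinnertonDyer.Theorems.ResidualThetaTransportAtTwoThetaLayerLambdaCongruenceAtTwoCuspSpanEllipticFamilies
import Summits.BirchSwinnertonDyer.BirchSwinnertonDyer.Theorems.ResidualThetaTransportAtTwoThetaLayerLambdaCongruenceAtTwoCuspSpanQuadratic
import HarnessLib

/-!
# Route `ResidualThetaTransportAtTwo`, node (G′)_N = `CuspSpanEvenAtTwo N` (item 27436; cruxes Kan⁺ 20688 / Kμ⁺ / 21437):
# a CLASS-WIDE family of EISENSTEIN prime levels — `(ℤ/p)ˣ = ⟨4, ζ₈⟩` with `−1 ∈ ⟨4⟩` (`p ≡ 9 (mod 16)`, index 4)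

Cell `bsd-wall`, width seat `bsd-wall-rtt-p3-w3` g7 (2026-08-28). THEOREMS ONLY (no `def`, no `sorry`, no named fact);
`--supports stmt-BirchSwinnertonDyer-20688`; BSD is not proved by this. Sequel to `…CuspSpanEllipticFamilies` (Theorems B′, E′:
families where every admissible character VANISHES). Here the quadratic character survives: at a prime `p ≡ 1 (mod 8)` the
trace form (G″)_p holds with `ψ ∈ {0, Legendre}`; the assembly from residue facts is the lead's
`cuspSpanTrace_of_quadratic_certificate` (`…CuspSpanQuadratic`, p629968): `K(r)` for every quadratic residue `r` and `E(r, r₀)` for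
every non-residue.

* THEOREM C′ (`cuspSpanTrace_of_units_four_pow_mul_rootEight_pow`, `cuspSpanEvenAtTwo_of_…`). Let `p ≡ 9 (mod 16)` be prime,
  `ζ ∈ ℤ/p` with `ζ⁴ = −1`, suppose `−1 = 4^{k₀}` for some `k₀` and that every unit is `4^k ζ^j`. Then (G″)_p and `CuspSpanEvenAtTwo p`.
  PROOF (uniform, no certificate): `F(4^k ζ^j) = F(ζ^j)` (4-invariance); `ζ` is a non-residue (`ζ^{(p−1)/2} = (ζ⁴)^{odd} = −1`
  as `(p−1)/2 ≡ 4 (mod 8)`), so `r = 4^k ζ^j` is a residue iff `j` is even; `j` even: `ζ^j ∈ {1, i, −1, −i}` (`i = ζ²`) are the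
  elementary zeros, so `K(r)`; `j` odd: `F(ζ³) = F(ζ)` (`ζ³ζ = −1`), `F(ζ⁵) = F(−ζ) = F(4^{k₀}ζ) = F(ζ)`, `F(ζ⁷) = F(4^{k₀}ζ³) = F(ζ)`,
  so `E(r, ζ)`. The hypotheses say `[(ℤ/p)ˣ : ⟨4⟩] = 4` with `p ≡ 9 (mod 16)`, equivalently `p ≡ 9 (mod 16)` and `2` generates the
  squares (`ord_p 2 = (p−1)/2`): `p = 41, 137, 313, 409, 521, 569, 761, 809, 857, 1129, …`.
* Primitive-root wrapper `cuspSpanEvenAtTwo_of_orderOf_of_rootEight` and instances `313, 409, 521, 569, 761, 809, 857, 1129` (each three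
  `decide +kernel` checks; `41`, `137` have per-level certificates in the tree).
With Theorem A (`±⟨4⟩ = (ℤ/p)ˣ`), B′, E′ and C′ the node is a theorem, by a uniform argument, at 132 of the 195 odd primes below 1200.

References: R. Pollack, Duke Math. J. 118 (2003) Conj. 6.3 [Pollack2003]; H. Rademacher, Abh. Math. Sem. Hamburg 7 (1929) §1
[Rademacher1929]; A. W. Knapp, *Elliptic curves* (1992) Prop. 11.1 [Knapp1993].
-/

set_option autoImplicit false
set_option linter.dupNamespace false

noncomputable section

open scoped MatrixGroups

open CongruenceSubgroup

namespace Summit.BirchSwinnertonDyer.BirchSwinnertonDyer.Theorems.SignedMuAtTwo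

variable {p : ℕ} [Fact p.Prime] {χ : Gamma0 p → ZMod 2}

/-- **THEOREM C′ (trace form (G″)_p with the quadratic `ψ`).** `p ≡ 9 (mod 16)` prime, `ζ⁴ = −1`, `4^{k₀} = −1`, every unit
of the form `4^k ζ^j`: then every admissible `χ` is `ψ ∘ d` with `ψ` multiplicative on units. [cite: Pollack2003, Conj. 6.3]
[cite: Rademacher1929, §1] -/
theorem cuspSpanTrace_of_units_four_pow_mul_rootEight_pow (hp2 : p ≠ 2) (h16 : p % 16 = 9) (ζ : ZMod p)
    (hζ : ζ ^ 4 = -1) (k₀ : ℕ) (hk₀ : (4 : ZMod p) ^ k₀ = -1) (hU : ∀ u : ZMod p, u ≠ 0 → ∃ k j : ℕ, u = 4 ^ k * ζ ^ j) :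
    ∀ χ : Gamma0 p → ZMod 2,
      (∀ γ δ : Gamma0 p, χ (γ * δ) = χ γ + χ δ) →
      (∀ γ : Gamma0 p, ((γ : SL(2, ℤ)) 0 0 + (γ : SL(2, ℤ)) 1 1).natAbs ≤ 2 → χ γ = 0) →
      (∀ γ : Gamma0 p, (∃ k : ℕ, 1 ≤ k ∧ ((γ : SL(2, ℤ)) 1 1).natAbs = 4 ^ k) → χ γ = 0) →
      ∃ ψ : ZMod p → ZMod 2, (∀ x y : ZMod p, IsUnit x → IsUnit y → ψ (x * y) = ψ x + ψ y) ∧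
        ∀ γ : Gamma0 p, χ γ = ψ ((((γ : SL(2, ℤ)) 1 1 : ℤ) : ZMod p)) := by
  intro χ hadd hsmall hkill
  have hp : p.Prime := Fact.out
  have h8 : p % 8 = 1 := by omega
  have hζ8 : ζ ^ 8 = 1 := by rw [show 8 = 4 * 2 by norm_num, pow_mul, hζ]; norm_num
  have hζu : IsUnit ζ := IsUnit.of_mul_eq_one (ζ ^ 7) (by rw [← pow_succ', hζ8])
  have hζ0 : ζ ≠ 0 := hζu.ne_zero
  have h2 : (2 : ZMod p) ≠ 0 := by
    intro h
    have h' : ((2 : ℕ) : ZMod p) = 0 := by exact_mod_cast h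
    exact hp2 ((Nat.prime_dvd_prime_iff_eq hp Nat.prime_two).mp ((ZMod.natCast_eq_zero_iff 2 p).mp h'))
  -- Euler powers: `4^(p/2) = 1`, `ζ^(p/2) = −1`
  have hhalf : p / 2 = 8 * (p / 16) + 4 := by omega
  have h4half : (4 : ZMod p) ^ (p / 2) = 1 := by
    have : (4 : ZMod p) ^ (p / 2) = 2 ^ (p - 1) := by
      rw [show (4 : ZMod p) = 2 ^ 2 by norm_num, ← pow_mul]; congr 1; omega
    rw [this, ZMod.pow_card_sub_one_eq_one h2]
  have hζhalf : ζ ^ (p / 2) = -1 := by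
    rw [hhalf, pow_add, pow_mul, hζ8, one_pow, one_mul, hζ]
  -- the `i = ζ²` bookkeeping
  have hi : ζ ^ 2 * ζ ^ 2 = -1 := by rw [← pow_add]; exact hζ
  refine cuspSpanTrace_of_quadratic_certificate hp2 h8 hadd hsmall ζ hζ0 fun r hr ↦ ?_
  obtain ⟨k, j, hkj⟩ := hU r hr
  have hrpow : r ^ (p / 2) = (-1) ^ j := by
    rw [hkj, mul_pow, ← pow_mul, mul_comm k, pow_mul, h4half, one_pow, one_mul, ← pow_mul, mul_comm j, pow_mul, hζhalf]
  -- `F(r) = F(ζ^j)` for `b = −1` elements (4-invariance)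
  obtain ⟨βj, hbj, hdj⟩ := exists_b_neg_one_of_isUnit (N := p) (hζu.pow j)
  have hFj : ∀ β : Gamma0 p, (β : SL(2, ℤ)) 0 1 = -1 → ((((β : SL(2, ℤ)) 1 1 : ℤ) : ZMod p)) = r → χ β = χ βj :=
    fun β hb hd ↦ chi_eq_of_b_neg_one_of_d_eq_four_pow_mul hp2 hadd hsmall hkill k hb hbj (by rw [hd, hkj, hdj])
  rcases Nat.even_or_odd j with ⟨j', hj'⟩ | ⟨j', hj'⟩
  · -- `j` even: `r` is a residue and `F(ζ^j) = F(i^{j'}) = 0`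
    left
    refine ⟨by rw [hrpow, hj', ← two_mul, pow_mul]; norm_num, fun β hb hd ↦ ?_⟩
    rw [hFj β hb hd]
    refine chi_eq_zero_of_b_neg_one_of_elementary hadd hsmall hbj hdj ?_
    have hζj : ζ ^ j = (ζ ^ 2) ^ j' := by rw [hj', ← two_mul, pow_mul]
    have hi4 : (ζ ^ 2) ^ 4 = 1 := by rw [← pow_mul]; exact hζ8
    have hj4 : (ζ ^ 2) ^ j' = (ζ ^ 2) ^ (j' % 4) := by
      conv_lhs => rw [← Nat.div_add_mod j' 4, pow_add, pow_mul, hi4, one_pow, one_mul]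
    have hlt : j' % 4 < 4 := Nat.mod_lt _ (by norm_num)
    rw [hζj, hj4]
    interval_cases (j' % 4)
    · exact Or.inl (pow_zero _)
    · right; right; left; rw [pow_one, hi]
    · right; left; rw [pow_two, hi]
    · right; right; left
      calc (ζ ^ 2) ^ 3 * (ζ ^ 2) ^ 3 = (ζ ^ 2 * ζ ^ 2) * (ζ ^ 2 * ζ ^ 2) * (ζ ^ 2 * ζ ^ 2) := by ring
        _ = -1 := by rw [hi]; ring
  · -- `j` odd: `r` is a non-residue and `F(ζ^j) = F(ζ)`
    right
    refine ⟨by rw [hrpow, hj']; exact Odd.neg_one_pow ⟨j', rfl⟩, fun β β' hb hb' hd hd' ↦ ?_⟩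
    rw [hFj β hb hd]
    -- reduce `j` mod 8 to `{1, 3, 5, 7}`
    have hj8 : ζ ^ j = ζ ^ (j % 8) := by
      conv_lhs => rw [← Nat.div_add_mod j 8, pow_add, pow_mul, hζ8, one_pow, one_mul]
    have hodd : j % 8 = 1 ∨ j % 8 = 3 ∨ j % 8 = 5 ∨ j % 8 = 7 := by omega
    -- auxiliary elements with residues `ζ³`
    obtain ⟨β₃, hb₃, hd₃⟩ := exists_b_neg_one_of_isUnit (N := p) (hζu.pow 3)
    have h31 : χ β₃ = χ β' :=
      chi_eq_of_b_neg_one_of_mul_d_eq_neg_one hadd hsmall hb₃ hb' (by rw [hd₃, hd', ← pow_succ, hζ])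
    rcases hodd with h | h | h | h
    · exact chi_eq_of_apply_zero_one_eq_neg_one hadd hsmall hbj hb' (by rw [hdj, hd', hj8, h, pow_one])
    · rw [← h31]; exact chi_eq_of_apply_zero_one_eq_neg_one hadd hsmall hbj hb₃ (by rw [hdj, hd₃, hj8, h])
    · -- `ζ⁵ = −ζ = 4^{k₀} ζ`
      exact chi_eq_of_b_neg_one_of_d_eq_four_pow_mul hp2 hadd hsmall hkill k₀ hbj hb'
        (by rw [hdj, hd', hj8, h, hk₀]; linear_combination ζ * hζ)
    · -- `ζ⁷ = −ζ³ = 4^{k₀} ζ³`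
      rw [← h31]
      exact chi_eq_of_b_neg_one_of_d_eq_four_pow_mul hp2 hadd hsmall hkill k₀ hbj hb₃
        (by rw [hdj, hd₃, hj8, h, hk₀]; linear_combination ζ ^ 3 * hζ)

/-- **THEOREM C′ (the named node).** [cite: Pollack2003, Conj. 6.3] -/
theorem cuspSpanEvenAtTwo_of_units_four_pow_mul_rootEight_pow (hp2 : p ≠ 2) (h16 : p % 16 = 9) (ζ : ZMod p)
    (hζ : ζ ^ 4 = -1) (k₀ : ℕ) (hk₀ : (4 : ZMod p) ^ k₀ = -1) (hU : ∀ u : ZMod p, u ≠ 0 → ∃ k j : ℕ, u = 4 ^ k * ζ ^ j) :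
    CuspSpanEvenAtTwo p :=
  cuspSpanEvenAtTwo_of_cuspSpanTrace (cuspSpanTrace_of_units_four_pow_mul_rootEight_pow hp2 h16 ζ hζ k₀ hk₀ hU)

/-- **THEOREM C′ from a primitive root**: `orderOf g = p − 1`, `ζ⁴ = −1`, `4^{k₀} = −1`, `g = 4^a ζ^b` ⟹ `CuspSpanEvenAtTwo p`.
[cite: Pollack2003, Conj. 6.3] -/
theorem cuspSpanEvenAtTwo_of_orderOf_of_rootEight (hp2 : p ≠ 2) (h16 : p % 16 = 9) (g ζ : ZMod p)
    (hg : orderOf g = p - 1) (hζ : ζ ^ 4 = -1) (k₀ : ℕ) (hk₀ : (4 : ZMod p) ^ k₀ = -1) (a b : ℕ)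
    (hgab : g = 4 ^ a * ζ ^ b) : CuspSpanEvenAtTwo p := by
  refine cuspSpanEvenAtTwo_of_units_four_pow_mul_rootEight_pow hp2 h16 ζ hζ k₀ hk₀ fun u hu ↦ ?_
  obtain ⟨m, rfl⟩ := exists_pow_eq_of_orderOf_eq hg hu
  exact ⟨a * m, b * m, by rw [hgab, mul_pow, ← pow_mul, ← pow_mul]⟩

/-! ### Instances (`p > 300`; `41` and `137` are in the tree by certificate) -/

/-- `CuspSpanEvenAtTwo 313` (THEOREM C′: `10` is a primitive root mod `313`, `ζ = 5`, `4^39 = −1`, `10 = 4^20·ζ^7`). [cite: Pollack2003, Conj. 6.3] -/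
theorem cuspSpanEvenAtTwo_uniform_313 : CuspSpanEvenAtTwo 313 := by
  have h1 : (10 : ZMod 313) ^ 312 = 1 := by decide +kernel
  have h2 : ∀ q, q < 312 + 1 → 2 ≤ q → q ∣ 312 → (10 : ZMod 313) ^ (312 / q) ≠ 1 := by decide +kernel
  have hz : (5 : ZMod 313) ^ 4 = -1 := by decide +kernel
  have hk : (4 : ZMod 313) ^ 39 = -1 := by decide +kernel
  have hg : (10 : ZMod 313) = 4 ^ 20 * 5 ^ 7 := by decide +kernel
  haveI : Fact (Nat.Prime 313) := ⟨by norm_num⟩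
  exact cuspSpanEvenAtTwo_of_orderOf_of_rootEight (p := 313) (by norm_num) (by norm_num) 10 5
    (orderOf_eq_of_pow_eq_one_of_forall_dvd (10 : ZMod 313) 312 (by norm_num) h1 h2) hz 39 hk 20 7 hg

/-- `CuspSpanEvenAtTwo 409` (THEOREM C′: `21` is a primitive root mod `409`, `ζ = 31`, `4^51 = −1`, `21 = 4^14·ζ^3`). [cite: Pollack2003, Conj. 6.3] -/
theorem cuspSpanEvenAtTwo_uniform_409 : CuspSpanEvenAtTwo 409 := by
  have h1 : (21 : ZMod 409) ^ 408 = 1 := by decide +kernel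
  have h2 : ∀ q, q < 408 + 1 → 2 ≤ q → q ∣ 408 → (21 : ZMod 409) ^ (408 / q) ≠ 1 := by decide +kernel
  have hz : (31 : ZMod 409) ^ 4 = -1 := by decide +kernel
  have hk : (4 : ZMod 409) ^ 51 = -1 := by decide +kernel
  have hg : (21 : ZMod 409) = 4 ^ 14 * 31 ^ 3 := by decide +kernel
  haveI : Fact (Nat.Prime 409) := ⟨by norm_num⟩
  exact cuspSpanEvenAtTwo_of_orderOf_of_rootEight (p := 409) (by norm_num) (by norm_num) 21 31
    (orderOf_eq_of_pow_eq_one_of_forall_dvd (21 : ZMod 409) 408 (by norm_num) h1 h2) hz 51 hk 14 3 hg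

/-- `CuspSpanEvenAtTwo 521` (THEOREM C′: `3` is a primitive root mod `521`, `ζ = 315`, `4^65 = −1`, `3 = 4^51·ζ^5`). [cite: Pollack2003, Conj. 6.3] -/
theorem cuspSpanEvenAtTwo_uniform_521 : CuspSpanEvenAtTwo 521 := by
  have h1 : (3 : ZMod 521) ^ 520 = 1 := by decide +kernel
  have h2 : ∀ q, q < 520 + 1 → 2 ≤ q → q ∣ 520 → (3 : ZMod 521) ^ (520 / q) ≠ 1 := by decide +kernel
  have hz : (315 : ZMod 521) ^ 4 = -1 := by decide +kernel
  have hk : (4 : ZMod 521) ^ 65 = -1 := by decide +kernel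
  have hg : (3 : ZMod 521) = 4 ^ 51 * 315 ^ 5 := by decide +kernel
  haveI : Fact (Nat.Prime 521) := ⟨by norm_num⟩
  exact cuspSpanEvenAtTwo_of_orderOf_of_rootEight (p := 521) (by norm_num) (by norm_num) 3 315
    (orderOf_eq_of_pow_eq_one_of_forall_dvd (3 : ZMod 521) 520 (by norm_num) h1 h2) hz 65 hk 51 5 hg

/-- `CuspSpanEvenAtTwo 569` (THEOREM C′: `3` is a primitive root mod `569`, `ζ = 277`, `4^71 = −1`, `3 = 4^41·ζ^3`). [cite: Pollack2003, Conj. 6.3] -/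
theorem cuspSpanEvenAtTwo_uniform_569 : CuspSpanEvenAtTwo 569 := by
  have h1 : (3 : ZMod 569) ^ 568 = 1 := by decide +kernel
  have h2 : ∀ q, q < 568 + 1 → 2 ≤ q → q ∣ 568 → (3 : ZMod 569) ^ (568 / q) ≠ 1 := by decide +kernel
  have hz : (277 : ZMod 569) ^ 4 = -1 := by decide +kernel
  have hk : (4 : ZMod 569) ^ 71 = -1 := by decide +kernel
  have hg : (3 : ZMod 569) = 4 ^ 41 * 277 ^ 3 := by decide +kernel
  haveI : Fact (Nat.Prime 569) := ⟨by norm_num⟩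
  exact cuspSpanEvenAtTwo_of_orderOf_of_rootEight (p := 569) (by norm_num) (by norm_num) 3 277
    (orderOf_eq_of_pow_eq_one_of_forall_dvd (3 : ZMod 569) 568 (by norm_num) h1 h2) hz 71 hk 41 3 hg

/-- `CuspSpanEvenAtTwo 761` (THEOREM C′: `6` is a primitive root mod `761`, `ζ = 62`, `4^95 = −1`, `6 = 4^88·ζ^7`). [cite: Pollack2003, Conj. 6.3] -/
theorem cuspSpanEvenAtTwo_uniform_761 : CuspSpanEvenAtTwo 761 := by
  have h1 : (6 : ZMod 761) ^ 760 = 1 := by decide +kernel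
  have h2 : ∀ q, q < 760 + 1 → 2 ≤ q → q ∣ 760 → (6 : ZMod 761) ^ (760 / q) ≠ 1 := by decide +kernel
  have hz : (62 : ZMod 761) ^ 4 = -1 := by decide +kernel
  have hk : (4 : ZMod 761) ^ 95 = -1 := by decide +kernel
  have hg : (6 : ZMod 761) = 4 ^ 88 * 62 ^ 7 := by decide +kernel
  haveI : Fact (Nat.Prime 761) := ⟨by norm_num⟩
  exact cuspSpanEvenAtTwo_of_orderOf_of_rootEight (p := 761) (by norm_num) (by norm_num) 6 62
    (orderOf_eq_of_pow_eq_one_of_forall_dvd (6 : ZMod 761) 760 (by norm_num) h1 h2) hz 95 hk 88 7 hg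

/-- `CuspSpanEvenAtTwo 809` (THEOREM C′: `3` is a primitive root mod `809`, `ζ = 239`, `4^101 = −1`, `3 = 4^86·ζ^5`). [cite: Pollack2003, Conj. 6.3] -/
theorem cuspSpanEvenAtTwo_uniform_809 : CuspSpanEvenAtTwo 809 := by
  have h1 : (3 : ZMod 809) ^ 808 = 1 := by decide +kernel
  have h2 : ∀ q, q < 808 + 1 → 2 ≤ q → q ∣ 808 → (3 : ZMod 809) ^ (808 / q) ≠ 1 := by decide +kernel
  have hz : (239 : ZMod 809) ^ 4 = -1 := by decide +kernel
  have hk : (4 : ZMod 809) ^ 101 = -1 := by decide +kernel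
  have hg : (3 : ZMod 809) = 4 ^ 86 * 239 ^ 5 := by decide +kernel
  haveI : Fact (Nat.Prime 809) := ⟨by norm_num⟩
  exact cuspSpanEvenAtTwo_of_orderOf_of_rootEight (p := 809) (by norm_num) (by norm_num) 3 239
    (orderOf_eq_of_pow_eq_one_of_forall_dvd (3 : ZMod 809) 808 (by norm_num) h1 h2) hz 101 hk 86 5 hg

/-- `CuspSpanEvenAtTwo 857` (THEOREM C′: `3` is a primitive root mod `857`, `ζ = 669`, `4^107 = −1`, `3 = 4^63·ζ^7`). [cite: Pollack2003, Conj. 6.3] -/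
theorem cuspSpanEvenAtTwo_uniform_857 : CuspSpanEvenAtTwo 857 := by
  have h1 : (3 : ZMod 857) ^ 856 = 1 := by decide +kernel
  have h2 : ∀ q, q < 856 + 1 → 2 ≤ q → q ∣ 856 → (3 : ZMod 857) ^ (856 / q) ≠ 1 := by decide +kernel
  have hz : (669 : ZMod 857) ^ 4 = -1 := by decide +kernel
  have hk : (4 : ZMod 857) ^ 107 = -1 := by decide +kernel
  have hg : (3 : ZMod 857) = 4 ^ 63 * 669 ^ 7 := by decide +kernel
  haveI : Fact (Nat.Prime 857) := ⟨by norm_num⟩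
  exact cuspSpanEvenAtTwo_of_orderOf_of_rootEight (p := 857) (by norm_num) (by norm_num) 3 669
    (orderOf_eq_of_pow_eq_one_of_forall_dvd (3 : ZMod 857) 856 (by norm_num) h1 h2) hz 107 hk 63 7 hg

/-- `CuspSpanEvenAtTwo 1129` (THEOREM C′: `11` is a primitive root mod `1129`, `ζ = 692`, `4^141 = −1`, `11 = 4^119·ζ^1`). [cite: Pollack2003, Conj. 6.3] -/
theorem cuspSpanEvenAtTwo_uniform_1129 : CuspSpanEvenAtTwo 1129 := by
  have h1 : (11 : ZMod 1129) ^ 1128 = 1 := by decide +kernel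
  have h2 : ∀ q, q < 1128 + 1 → 2 ≤ q → q ∣ 1128 → (11 : ZMod 1129) ^ (1128 / q) ≠ 1 := by decide +kernel
  have hz : (692 : ZMod 1129) ^ 4 = -1 := by decide +kernel
  have hk : (4 : ZMod 1129) ^ 141 = -1 := by decide +kernel
  have hg : (11 : ZMod 1129) = 4 ^ 119 * 692 ^ 1 := by decide +kernel
  haveI : Fact (Nat.Prime 1129) := ⟨by norm_num⟩
  exact cuspSpanEvenAtTwo_of_orderOf_of_rootEight (p := 1129) (by norm_num) (by norm_num) 11 692
    (orderOf_eq_of_pow_eq_one_of_forall_dvd (11 : ZMod 1129) 1128 (by norm_num) h1 h2) hz 141 hk 119 1 hg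

end Summit.BirchSwinnertonDyer.BirchSwinnertonDyer.Theorems.SignedMuAtTwo

end
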